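import Summits.BirchSwinnertonDyer.BirchSwinnertonDyer.Theorems.TameQuarticSolventSolventPairLowerBoundTwistDescent
import Summits.BirchSwinnertonDyer.BirchSwinnertonDyer.Theorems.TameQuarticSolventSolventPairLowerBoundSolventField
import HarnessLib

/-!
# Route `TameQuarticSolvent`, crux `SolventPairLowerBound` (stmt-BirchSwinnertonDyer-21391), line `birth`:
# the twisted constituent `E′ = (E_K)^{(β)}` of K2a has GOOD SUPERSINGULAR reduction, `a_𝔭 = 0`, at every
# place `𝔭 ∣ 3` with `e(𝔭|3) ≡ 2·ord_𝔭 β (mod 4)` — in particular at the ramified prime of `K = ℚ(√d)`,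
# `3 ∥ d`, for every `β` of odd `𝔭`-valuation

HONEST FRAMING. Theorems only; helper toward the deciding crux `SolventPairLowerBound` of route
`TameQuarticSolvent` (`--supports stmt-BirchSwinnertonDyer-21391`). It makes a kernel theorem of the local
fact the registered stub K2a (`stub_kolyvaginTwistedUpperOverK` of skeleton v5, `Cruxes/…/Lines/birth.lean`) is
about: the curve `E′ = (E_K)^{(β)}` whose `3`-part upper bound K2a asks for is NOT additive at the prime `𝔭 ∣ 3`
of `K = ℚ(√d)` but has GOOD supersingular reduction there with `a_𝔭 = 0` and `#Ẽ′(𝔽₃) = 4` (`e(𝔭|3) = 2 = p − 1`;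
parity memo PARITY-K2A-w2 §3, third bullet, there informal; Serre–Tate: the order-4 tame inertia image of a
(t′) curve meets `I_{K_𝔭}` in `{±1}` and the ramified quadratic character `χ_β` cancels it). Neither K2a nor K1⁻
is proved here; the crux stays OPEN and BSD is not proved by any of this. No route file is imported.

WHAT (engine: `…TwistDescent.lean`, the twisted tame descent for any odd `p`).
* §3 the (t′) leaf at `3`: `frobeniusTraceAt_quadraticTwist_baseChange_eq_zero_of_subTprime` — for `W/ℚ`
  globally minimal, elliptic, `Addv W 3`, `SubTprime W 3`, every number field `L`, place `w ∣ 3` of ramification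
  index `e` and ODD residue degree, and `β ∈ L` with `w(β) = exp B` and `e = 4m + 2B` for some `m ∈ ℤ`:
  `(W_L)^{(β)}` has good reduction at `w` with `a_w = 0` (rational medium model `exists_rat_model_of_subTprime`,
  `k ∈ {1,3}` odd, `M = (2m + B)k`); model-free form
  `hasGoodReductionAt_and_frobeniusTraceAt_eq_zero_of_smul_quadraticTwist_eq`. The landed `stub_goodReduction` /
  `frobeniusTraceAt_baseChange_eq_zero_of_subTprime` are `β = 1`, `e = 4`; good reduction alone for `e = 2`,
  `ord β` odd is the width seat's `…TwistGoodReduction.lean` (p584727).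
* §4 the K2a shape: `hasGoodReductionAt_and_frobeniusTraceAt_eq_zero_of_sq_eq_intCast`,
  `hasGoodReductionAt_quadraticTwist_of_sq_eq_intCast` — over `K` with `θ₁² = d`, `[K:ℚ] = 2`, `ord₃ d = 1`,
  for every `β` of odd valuation at every `v ∣ 3` and every model `Vβ` of `(W_K)^{(β)}`: good reduction,
  `a_v = 0` and `#Ṽβ_v(𝔽₃) = 4` at every `v ∣ 3` (`e(v|3) = 2`, `f = 1`).

References: J. H. Silverman, *AEC* VII.1 (Remark 1.1, Prop. 1.3(b)), VII.5.1(a), X.5 Cor. 5.4, C.§16;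
K. Ireland, M. Rosen, *A Classical Introduction to Modern Number Theory*, Ch. 18 §4 Thm. 5;
J.-P. Serre, J. Tate, Ann. of Math. 88 (1968) §2 Cor. 2; I. Papadopoulos, J. Number Theory 44 (1993) Table III.
-/

-- D-0017: single-problem summit, so `Summit.BirchSwinnertonDyer.BirchSwinnertonDyer.…` repeats a namespace BY DESIGN.
set_option linter.dupNamespace false

noncomputable section

open scoped NumberField Classical

open IsDedekindDomain IsDedekindDomain.HeightOneSpectrum NumberField WeierstrassCurve
  Literature.NumberTheory.EllipticCurves Literature.NumberTheory.EllipticCurves.Rank1Residual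
  Summit.BirchSwinnertonDyer.Rank1Residual.Additive

namespace Summit.BirchSwinnertonDyer.BirchSwinnertonDyer.Theorems.SolventPairLowerBound

section Transport

variable {L : Type} [Field L] [NumberField L]

/-- Twisting commutes with base change of a change of variables: for `X = C₀ • W` over `ℚ`,
`(X ⊗ L)^{(β)} = (u, β r, 0, 0) • (W ⊗ L)^{(β)}` (tree `WeierstrassCurve.quadraticTwist_smul`,
Silverman *AEC* III.1 Table 3.1). [folklore] -/
theorem quadraticTwist_baseChange_smul (W : WeierstrassCurve ℚ) (C₀ : VariableChange ℚ) (β : L) :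
    ((C₀ • W).baseChange L).quadraticTwist β =
      (⟨(C₀.map (algebraMap ℚ L)).u, β * (C₀.map (algebraMap ℚ L)).r, 0, 0⟩ : VariableChange L) •
        (W.baseChange L).quadraticTwist β := by
  haveI : NeZero (2 : L) := ⟨two_ne_zero⟩
  have hbc : (C₀ • W).baseChange L = (C₀.map (algebraMap ℚ L)) • W.baseChange L := by
    rw [WeierstrassCurve.baseChange, ← map_variableChange]; rfl
  rw [hbc, WeierstrassCurve.quadraticTwist_smul]

end Transport

/-! ## §3 The (t′) leaf at `3` -/

section Tprime

variable (W : WeierstrassCurve ℚ) [W.IsElliptic] [W.IsGloballyMinimal]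

/-- The arithmetic of the (t′) exponents: from the rational model data `k ∈ {1, 3}`, `ord₃ Δ = 3k`,
`i k ≤ 4 ord₃ aᵢ` and a ramification index `e = 4m + 2B`, the integer `M := (2m + B) k` satisfies
`e · ord₃ Δ = 6M`, `M ≡ B (mod 2)`, `i M ≤ 2e · ord₃ aᵢ`, and `i M < 2e · ord₃ aᵢ` whenever `i k < 4 ord₃ aᵢ` and
`e ≠ 0`. [folklore] -/
theorem tprime_exponent_arith {k : ℕ} (hk : k = 1 ∨ k = 3) {e : ℕ} {m B : ℤ} (heB : (e : ℤ) = 4 * m + 2 * B) :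
    (∃ m' : ℤ, (2 * m + B) * k = 2 * m' + B) ∧
    ((e : ℤ) * (3 * k : ℤ) = 6 * ((2 * m + B) * k)) ∧
    (∀ (i : ℤ) (x : ℚ), 0 ≤ i → i * (k : ℤ) ≤ 4 * padicValRat 3 x →
      i * ((2 * m + B) * k) ≤ 2 * e * padicValRat 3 x) ∧
    (∀ (i : ℤ) (x : ℚ), 0 ≤ i → e ≠ 0 → i * (k : ℤ) < 4 * padicValRat 3 x →
      i * ((2 * m + B) * k) < 2 * e * padicValRat 3 x) := by
  have he2 : (e : ℤ) = 2 * (2 * m + B) := by rw [heB]; ring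
  have hnn : (0 : ℤ) ≤ 2 * m + B := by
    have : (0 : ℤ) ≤ e := by positivity
    linarith
  refine ⟨?_, by rw [he2]; ring, ?_, ?_⟩
  · rcases hk with rfl | rfl
    · exact ⟨m, by push_cast; ring⟩
    · exact ⟨3 * m + B, by push_cast; ring⟩
  · intro i x hi h
    have h' : (2 * m + B) * (i * (k : ℤ)) ≤ (2 * m + B) * (4 * padicValRat 3 x) :=
      mul_le_mul_of_nonneg_left h hnn
    calc i * ((2 * m + B) * k) = (2 * m + B) * (i * (k : ℤ)) := by ring
      _ ≤ (2 * m + B) * (4 * padicValRat 3 x) := h'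
      _ = 2 * e * padicValRat 3 x := by rw [he2]; ring
  · intro i x hi he0 h
    have hpos : (0 : ℤ) < 2 * m + B := by
      rcases hnn.lt_or_eq with h0 | h0
      · exact h0
      · exfalso; apply he0; have : (e : ℤ) = 0 := by rw [he2, ← h0]; ring
        exact_mod_cast this
    have h' : (2 * m + B) * (i * (k : ℤ)) < (2 * m + B) * (4 * padicValRat 3 x) :=
      mul_lt_mul_of_pos_left h hpos
    calc i * ((2 * m + B) * k) = (2 * m + B) * (i * (k : ℤ)) := by ring
      _ < (2 * m + B) * (4 * padicValRat 3 x) := h'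
      _ = 2 * e * padicValRat 3 x := by rw [he2]; ring

/-- **Twisted tame descent on the (t′) leaf: GOOD SUPERSINGULAR reduction, `a_w = 0`.** Let `W/ℚ` be
globally minimal, elliptic, additive at `3` of census class (t′) (`Addv W 3`, `SubTprime W 3`: tame, `e = 4`,
Kodaira `III`/`III*`). For every number field `L`, place `w ∣ 3` of ramification index `e(w|3) = e` and ODD
residue degree `f(w|3)` (so `#k_w = 3^f ≡ 3 (mod 4)`), and `β ∈ L` with `w(β) = exp B` such that `e = 4m + 2B`
for some integer `m` — i.e. `e(w|3) ≡ 2·ord_w β (mod 4)` — the quadratic twist `(W ⊗ L)^{(β)}` has GOOD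
reduction at `w` with `a_w = 0`. Cases: `β = 1`, `e = 4` (the landed `stub_goodReduction` /
`frobeniusTraceAt_baseChange_eq_zero_of_subTprime`); `e(w|3) = 2` and `ord_w β` odd (the K2a constituent
`E′ = (E_K)^{(β)}` over `K = ℚ(√d)`, `3 ∥ d`; good reduction alone there is the width seat's
`hasGoodReductionAt_quadraticTwist_baseChange_of_subTprime`, p584727). Proof: rational medium model
(`exists_rat_model_of_subTprime`: `ord₃ Δ = 3k`, `i k ≤ 4 ord₃ aᵢ`, `k ∈ {1,3}` odd, hence `<` for `i ≠ 4`)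
and the engine `frobeniusTraceAt_quadraticTwist_baseChange_eq_zero_of_padicValRat` with `M = (2m + B)k`; the
twist of the model is a change of variables away from the twist of `W` (`quadraticTwist_baseChange_smul`), and
good reduction / `a_w` are invariants. Serre–Tate picture: the order-`4` tame inertia image is killed on
`I_{L_w}` by `χ_β` exactly under this congruence, and Frobenius swaps the `±i`-eigenlines, so `tr = 0`.
[cite: IrelandRosen1990, Ch. 18 §4, Theorem 5] [cite: SilvermanAEC2009, VII.1 Prop. 1.3(b), VII.5.1(a), C.§16]
[cite: SerreTate1968, §2 Cor. 2] [cite: Papadopoulos1993, Table III (p = 3)] -/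
theorem frobeniusTraceAt_quadraticTwist_baseChange_eq_zero_of_subTprime (hadd : Addv W 3)
    (hsub : Summit.BirchSwinnertonDyer.Rank1Residual.Additive.SubTprime W 3)
    (L : Type) [Field L] [NumberField L] (w : HeightOneSpectrum (𝓞 L))
    (h3 : ((3 : ℕ) : 𝓞 L) ∈ w.asIdeal) {e : ℕ} (he : w.asIdeal.ramificationIdx ℤ = e)
    (hf : Odd (w.asIdeal.inertiaDeg ℤ))
    (β : L) {B : ℤ} (hβ : w.valuation L β = WithZero.exp B) (heB : ∃ m : ℤ, (e : ℤ) = 4 * m + 2 * B) :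
    ((W.baseChange L).quadraticTwist β).HasGoodReductionAt w ∧
      ((W.baseChange L).quadraticTwist β).frobeniusTraceAt w = 0 := by
  have hq := natCard_quotient_mod_four_of_odd_inertiaDeg L w h3 hf
  obtain ⟨m, hm⟩ := heB
  obtain ⟨C₀, k, hk, hΔ, h₁, h₂, h₃, h₄, h₆⟩ := exists_rat_model_of_subTprime W hadd hsub
  obtain ⟨hpar, hΔ', hle, hlt⟩ := tprime_exponent_arith hk hm
  haveI := w.isPrime
  have he0 : e ≠ 0 := by rw [← he]; exact (Ideal.ramificationIdx_pos (q := w.asIdeal) (R := ℤ)).ne'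
  -- `k` is odd, so `i k ≤ 4 ord aᵢ` is strict for `i = 1, 2, 3, 6`
  have hstrict : ∀ {i : ℤ} {x : ℚ}, (i = 1 ∨ i = 2 ∨ i = 3 ∨ i = 6) → i * (k : ℤ) ≤ 4 * padicValRat 3 x →
      i * (k : ℤ) < 4 * padicValRat 3 x := by
    intro i x hi h
    rcases h.lt_or_eq with h' | h'
    · exact h'
    · exfalso
      have hdvd : (4 : ℤ) ∣ i * k := ⟨padicValRat 3 x, by linarith⟩
      rcases hk with rfl | rfl <;> rcases hi with rfl | rfl | rfl | rfl <;> omega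
  haveI : (C₀ • W).IsElliptic := inferInstance
  have hX := frobeniusTraceAt_quadraticTwist_baseChange_eq_zero_of_padicValRat (C₀ • W) 3 (by norm_num)
      (e := e) (M := (2 * m + B) * k) (B := B) (by rw [hΔ]; exact hΔ')
      (h₁.imp id fun h ↦ by
        simpa using hlt 1 _ (by norm_num) he0 (hstrict (by norm_num) (by simpa using h)))
      (h₂.imp id fun h ↦ hlt 2 _ (by norm_num) he0 (hstrict (by norm_num) h))
      (h₃.imp id fun h ↦ hlt 3 _ (by norm_num) he0 (hstrict (by norm_num) h))
      (h₄.imp id fun h ↦ hle 4 _ (by norm_num) h)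
      (h₆.imp id fun h ↦ hlt 6 _ (by norm_num) he0 (hstrict (by norm_num) h))
      w h3 he hq β hβ hpar
  obtain ⟨hgoodX, hzero⟩ := hX
  haveI : NeZero (2 : L) := ⟨two_ne_zero⟩
  have hβ0 : β ≠ 0 := by
    intro h0; rw [h0, map_zero] at hβ; exact WithZero.exp_ne_zero hβ.symm
  haveI : (W.baseChange L).IsElliptic := by
    rw [WeierstrassCurve.baseChange]; infer_instance
  haveI : ((W.baseChange L).quadraticTwist β).IsElliptic := isElliptic_quadraticTwist _ hβ0
  rw [quadraticTwist_baseChange_smul] at hgoodX hzero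
  have hgoodW : ((W.baseChange L).quadraticTwist β).HasGoodReductionAt w :=
    (hasGoodReductionAt_smul_iff_holds w _ _).mp hgoodX
  rw [WeierstrassCurve.frobeniusTraceAt_smul _ _ w hgoodW] at hzero
  exact ⟨hgoodW, hzero⟩

/-- **Model-free form.** For any `L`-model `V` of the twist (`C • (W ⊗ L)^{(β)} = V`), under the hypotheses of
`frobeniusTraceAt_quadraticTwist_baseChange_eq_zero_of_subTprime`: `V` has good reduction at `w` and
`a_w(V) = 0` (both are invariants of the `L`-isomorphism class; Silverman VII.1.3(b)).
[cite: SilvermanAEC2009, VII.1 Prop. 1.3(b) and C.§16] -/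
theorem hasGoodReductionAt_and_frobeniusTraceAt_eq_zero_of_smul_quadraticTwist_eq (hadd : Addv W 3)
    (hsub : Summit.BirchSwinnertonDyer.Rank1Residual.Additive.SubTprime W 3)
    (L : Type) [Field L] [NumberField L] (w : HeightOneSpectrum (𝓞 L))
    (h3 : ((3 : ℕ) : 𝓞 L) ∈ w.asIdeal) {e : ℕ} (he : w.asIdeal.ramificationIdx ℤ = e)
    (hf : Odd (w.asIdeal.inertiaDeg ℤ))
    (β : L) {B : ℤ} (hβ : w.valuation L β = WithZero.exp B) (heB : ∃ m : ℤ, (e : ℤ) = 4 * m + 2 * B)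
    (V : WeierstrassCurve L) {C : VariableChange L} (hV : C • (W.baseChange L).quadraticTwist β = V) :
    V.HasGoodReductionAt w ∧ V.frobeniusTraceAt w = 0 := by
  obtain ⟨hgood, hzero⟩ :=
    frobeniusTraceAt_quadraticTwist_baseChange_eq_zero_of_subTprime W hadd hsub L w h3 he hf β hβ heB
  haveI : NeZero (2 : L) := ⟨two_ne_zero⟩
  have hβ0 : β ≠ 0 := by
    intro h0; rw [h0, map_zero] at hβ; exact WithZero.exp_ne_zero hβ.symm
  haveI : (W.baseChange L).IsElliptic := by
    rw [WeierstrassCurve.baseChange]; infer_instance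
  haveI : ((W.baseChange L).quadraticTwist β).IsElliptic := isElliptic_quadraticTwist _ hβ0
  subst hV
  exact ⟨(hasGoodReductionAt_smul_iff_holds w _ C).mpr hgood,
    by rw [WeierstrassCurve.frobeniusTraceAt_smul _ C w hgood, hzero]⟩

end Tprime

/-! ## §4 The K2a shape: the twisted constituent over `K = ℚ(√d)`, `3 ∥ d` -/

section K2aShape

variable (W : WeierstrassCurve ℚ) [W.IsElliptic] [W.IsGloballyMinimal]

/-- **The K2a constituent `E′ = (E_K)^{(β)}` is GOOD SUPERSINGULAR at every place above `3`, with `a_v = 0`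
and `#Ẽ′_v(𝔽₃) = 4`.** Let `W/ℚ` be globally minimal, elliptic, of census class (t′) at `3` (`Addv W 3`,
`SubTprime W 3`); `K` a number field with `[K:ℚ] = 2` and `θ₁² = d`, `ord₃ d = 1` (so `K = ℚ(√d)` and the place
`v ∣ 3` is ramified, `e(v|3) = 2`, `f(v|3) = 1`); `β ∈ K` of ODD valuation at every place above `3` (the
admissible class of stub K2a `stub_kolyvaginTwistedUpperOverK`, e.g. `β = d + √d`); and `Vβ` ANY `K`-model of
the twist, `C • (W ⊗ K)^{(β)} = Vβ`. Then at every `v ∣ 3`: `Vβ` has good reduction, `a_v(Vβ) = 0`, and the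
reduction has exactly `4` points over `k_v = 𝔽₃`. (So the object of K2a is an elliptic curve over a real
quadratic field with good supersingular reduction at the prime above `p = 3`, `e = 2 = p − 1` — not an
additive one.) Proof: `e(v|3) = 2` (`ramificationIdx_eq_two_of_sq_eq_intCast`), `e·f ≤ 2` forces `f = 1`, and
`2 = 4·(−k) + 2·(2k+1)`; apply `hasGoodReductionAt_and_frobeniusTraceAt_eq_zero_of_smul_quadraticTwist_eq`.
[cite: SerreTate1968, §2 Cor. 2] [cite: SilvermanAEC2009, VII.5.1(a) and C.§16]
[cite: IrelandRosen1990, Ch. 18 §4, Theorem 5] -/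
theorem hasGoodReductionAt_and_frobeniusTraceAt_eq_zero_of_sq_eq_intCast (hadd : Addv W 3)
    (hsub : Summit.BirchSwinnertonDyer.Rank1Residual.Additive.SubTprime W 3)
    {d : ℤ} (hd : padicValInt 3 d = 1) (K : Type) [Field K] [NumberField K] {θ₁ : K}
    (h2 : Module.finrank ℚ K = 2) (hθ₁ : θ₁ ^ 2 = (d : K)) (β : K)
    (hval : ∀ v : HeightOneSpectrum (𝓞 K), ((3 : ℕ) : 𝓞 K) ∈ v.asIdeal →
      ∃ k : ℤ, v.valuation K β = WithZero.exp (2 * k + 1))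
    (Vβ : WeierstrassCurve K) {C : VariableChange K} (hV : C • (W.baseChange K).quadraticTwist β = Vβ)
    (v : HeightOneSpectrum (𝓞 K)) (hv : ((3 : ℕ) : 𝓞 K) ∈ v.asIdeal) :
    Vβ.HasGoodReductionAt v ∧ Vβ.frobeniusTraceAt v = 0 ∧
      Nat.card ((Vβ.reductionAt v).toAffine.Point) = 4 := by
  haveI : Fact (Nat.Prime 3) := ⟨Nat.prime_three⟩
  have he : v.asIdeal.ramificationIdx ℤ = 2 := (ramificationIdx_eq_two_of_sq_eq_intCast 3 h2 hθ₁ hd v hv).1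
  -- `f(v|3) = 1`
  have hef := ramificationIdx_mul_inertiaDeg_le_finrank K v Nat.prime_three hv
  rw [he, h2] at hef
  haveI : v.asIdeal.LiesOver (Ideal.span {((3 : ℕ) : ℤ)}) := liesOver_span_of_natCast_mem 3 K v hv
  haveI := v.isMaximal
  haveI : (Ideal.span {((3 : ℕ) : ℤ)}).IsMaximal :=
    Ideal.IsPrime.isMaximal ((Ideal.span_singleton_prime (by norm_num)).mpr (by norm_num)) (by simp)
  have hf0 : v.asIdeal.inertiaDeg ℤ ≠ 0 := by
    rw [← Ideal.inertiaDeg'_eq_inertiaDeg (Ideal.span {((3 : ℕ) : ℤ)}) v.asIdeal]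
    exact Ideal.inertiaDeg'_ne_zero _ _
  have hf1 : v.asIdeal.inertiaDeg ℤ = 1 := by omega
  have hf : Odd (v.asIdeal.inertiaDeg ℤ) := by rw [hf1]; exact odd_one
  -- the parity condition `e = 4m + 2B` with `e = 2`, `B = 2k + 1`, `m = -k`
  obtain ⟨k, hk⟩ := hval v hv
  have heB : ∃ m : ℤ, ((2 : ℕ) : ℤ) = 4 * m + 2 * (2 * k + 1) := ⟨-k, by push_cast; ring⟩
  obtain ⟨hgood, hzero⟩ := hasGoodReductionAt_and_frobeniusTraceAt_eq_zero_of_smul_quadraticTwist_eq W hadd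
    hsub K v hv he hf β hk heB Vβ hV
  refine ⟨hgood, hzero, ?_⟩
  have hcard : Nat.card (𝓞 K ⧸ v.asIdeal) = 3 := by
    rw [← Submodule.cardQuot_apply, ← Ideal.absNorm_apply,
      Ideal.absNorm_eq_pow_inertiaDeg' v.asIdeal Nat.prime_three, Ideal.inertiaDeg'_eq_inertiaDeg, hf1,
      pow_one]
  have hβ0 : β ≠ 0 := by
    intro h0; rw [h0, map_zero] at hk; exact WithZero.exp_ne_zero hk.symm
  haveI : NeZero (2 : K) := ⟨two_ne_zero⟩
  haveI : (W.baseChange K).IsElliptic := by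
    rw [WeierstrassCurve.baseChange]; infer_instance
  haveI : ((W.baseChange K).quadraticTwist β).IsElliptic := isElliptic_quadraticTwist _ hβ0
  haveI : Vβ.IsElliptic := by rw [← hV]; infer_instance
  have h := hzero
  rw [frobeniusTraceAt_def, IsDedekindDomain.HeightOneSpectrum.natCard_residueField_adicCompletionIntegers K v,
    hcard] at h
  omega

/-- **Corollary (K2a's place `v ∣ 3` is a good supersingular place of `E′`, stated on the twist itself).**
For `W` on the (t′) leaf, `K ⊃ ℚ` quadratic with `θ₁² = d`, `ord₃ d = 1`, and `β` of odd valuation above `3`: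
`(W ⊗ K)^{(β)}` has good reduction with `a_v = 0` at every `v ∣ 3`. [cite: SerreTate1968, §2 Cor. 2]
[cite: SilvermanAEC2009, VII.5.1(a) and C.§16] -/
theorem hasGoodReductionAt_quadraticTwist_of_sq_eq_intCast (hadd : Addv W 3)
    (hsub : Summit.BirchSwinnertonDyer.Rank1Residual.Additive.SubTprime W 3)
    {d : ℤ} (hd : padicValInt 3 d = 1) (K : Type) [Field K] [NumberField K] {θ₁ : K}
    (h2 : Module.finrank ℚ K = 2) (hθ₁ : θ₁ ^ 2 = (d : K)) (β : K)
    (hval : ∀ v : HeightOneSpectrum (𝓞 K), ((3 : ℕ) : 𝓞 K) ∈ v.asIdeal →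
      ∃ k : ℤ, v.valuation K β = WithZero.exp (2 * k + 1))
    (v : HeightOneSpectrum (𝓞 K)) (hv : ((3 : ℕ) : 𝓞 K) ∈ v.asIdeal) :
    ((W.baseChange K).quadraticTwist β).HasGoodReductionAt v ∧
      ((W.baseChange K).quadraticTwist β).frobeniusTraceAt v = 0 := by
  obtain ⟨hgood, hzero, -⟩ := hasGoodReductionAt_and_frobeniusTraceAt_eq_zero_of_sq_eq_intCast W hadd hsub hd
    K h2 hθ₁ β hval ((W.baseChange K).quadraticTwist β) (C := 1) (one_smul _ _) v hv
  exact ⟨hgood, hzero⟩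

end K2aShape

end Summit.BirchSwinnertonDyer.BirchSwinnertonDyer.Theorems.SolventPairLowerBound

end
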